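import Literature.Analysis.FluidPDE.HomogeneousEulerZonalSpectralGap
import HarnessLib

/-!
# Bernoulli-free axisymmetric homogeneous Euler flows are trivial for `0 < α < 1`
# (Shvydkoy 2018, Prop. 3.2, the case `α < 1`, in zonal ODE form)

R. Shvydkoy, *Homogeneous solutions to the 3D Euler system*, Trans. Amer. Math. Soc. 370 (2018)
2517–2535 = arXiv:1510.03378 [`Shvydkoy2018`], Proposition 3.2 (arXiv p. 8): "For `α ≤ 2`
irrotational solutions are unique in the class of all `C²`-smooth solutions with `H = 0`", whose
case `α < 1` is proved in print through the identity
`div(f ωⁿ v) = (n+α-2) f² ωⁿ + (1-α)(n+1) |v|² ωⁿ` (even `n`), giving `ω v = f u = 0`, then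
`u = 0` on `{f ≠ 0}`, the Laplace equation `Δf = -(2-α)(1-α) f` there and on its closure, and
finally Prop. 3.1 (`f` a spherical harmonic, impossible for `α ∉ ℤ`). With the first half of
the proof of Prop. 5.1 (`H ≡ 0`, `0 < α < 2`) and the window case `1 < α < 2`
(`HomogeneousEulerBernoulliRigidity.lean`) this excludes `C²` axisymmetric homogeneous stationary
Euler flows for all `0 < α < 2` (Prop. 5.1 = fact `shvydkoy2018_prop51_noAxisymmetric`).

This file proves the AXISYMMETRIC case of that `α < 1` statement as a theorem about the profile
functions `a = ⟪v, e_φ⟫`, `b = ⟪v, e_θ⟫` (swirl), `f` (normal component) of the polar angle, for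
which every sphere-calculus step of the printed proof is an ODE manipulation on `(0, π)`:
* `Shvydkoy2018.zonal_rigidity_of_bernoulli_zero` — `0 < α < 1`; `a ∈ C¹`, `b, f ∈ C²` (as
  functions on `ℝ`, `f''` continuous); the axisymmetric reduced system (Shvydkoy (5.1)–(5.4) =
  (6) in the frame `e_φ, e_θ`) with `H ≡ 0`, i.e. `2p = -(a² + b² + f²)`, multiplied by `sin φ`:
  `sin φ·a' = -(2-α) sin φ·f - cos φ·a`, `a f' = (1-α)(a² + b²)`,
  `sin φ·(b b' + f f') = (1-α) sin φ·f a - cos φ·b²`, `sin φ·a b' = -(1-α) sin φ·f b - cos φ·a b`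
  on `(0,π)`; pole conditions `b(0) = b(π) = 0`, `f'(0) = f'(π) = 0`. Conclusion: `a = b = f = 0`
  on `[0, π]`.

## Proof (the printed steps, zonally)

With `ω = b' + b cot φ`: the swirl equation is `a ω = -(1-α) f b` (R4), the `e_θ`-momentum
equation is `f f' = (1-α) f a - ω b` (R3) (Shvydkoy's `f u = ω v`), and differentiating (R4)
supplies (17). The case `n = 2` of the divergence identity reads
`(sin φ · f a ω²)' = sin φ · ω² (α f² + 3(1-α)(a²+b²)) ≥ 0`; `Φ = sin φ · f a ω²` is monotone on
`[0,π]` and tends to `0` at both poles (`b/sin φ → ±b'`), so `Φ' ≡ 0`: pointwise `ω = 0` or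
`a = b = f = 0`, whence `f((1-α) a - f') = 0`. On `{f ≠ 0}` thus `f' = (1-α) a` and `(6)₁` is
the zonal Legendre equation `sin φ f'' + cos φ f' = -(2-α)(1-α) sin φ f`, which extends to
`(0,π)` (closure by continuity, trivially off it); the zonal spectral gap
(`zonal_eigenfunction_eq_zero`) gives `f ≡ 0`, then `(sin φ·a)' = ((sin φ·b)²)' = 0` give
`a = b = 0`. Pure real analysis (unbundled `HasDerivAt` data); the bulk-to-zonal dictionary is
the meridian calculus of the Prop. 5.1 files. `C²` enters as in print: `ω'` needs `b ∈ C²`,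
continuity of `f''` carries the Legendre equation to the closure.

## References

* R. Shvydkoy, Trans. AMS 370 (2018) 2517–2535 = arXiv:1510.03378: §3 (16)–(18), Props. 3.1,
  3.2 (proof p. 8), §5 (5.1)–(5.4), Prop. 5.1. [`Shvydkoy2018`]
-/

noncomputable section

open Set Filter
open scoped Topology

namespace Literature.Analysis.FluidPDE

namespace Shvydkoy2018
/-- A continuous function on `[a, b]` with zero derivative on `(a, b)` is constant there
(mean value theorem, packaged for one-sided use). [folklore] -/
private theorem eq_of_hasDerivAt_zero_Ioo {g : ℝ → ℝ} {a b : ℝ} (hab : a ≤ b)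
    (hcont : ContinuousOn g (Icc a b)) (hderiv : ∀ x ∈ Ioo a b, HasDerivAt g 0 x) :
    ∀ x ∈ Icc a b, g x = g a := by
  have hdiff : DifferentiableOn ℝ g (interior (Icc a b)) := by
    rw [interior_Icc]; exact fun x hx => (hderiv x hx).differentiableAt.differentiableWithinAt
  have hd0 : ∀ x ∈ interior (Icc a b), deriv g x = 0 := by
    rw [interior_Icc]; exact fun x hx => (hderiv x hx).deriv
  have hmono : MonotoneOn g (Icc a b) :=
    monotoneOn_of_deriv_nonneg (convex_Icc a b) hcont hdiff fun x hx => (hd0 x hx).symm.le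
  have hanti : AntitoneOn g (Icc a b) :=
    antitoneOn_of_deriv_nonpos (convex_Icc a b) hcont hdiff fun x hx => (hd0 x hx).le
  intro x hx
  have ha : a ∈ Icc a b := left_mem_Icc.mpr hab
  exact le_antisymm (hanti ha hx hx.1) (hmono ha hx hx.1)


/-! ### Bernoulli-free axisymmetric rigidity for `0 < α < 1` (Prop. 3.2, hard case, zonal form) -/

/-- L'Hôpital at a zero of `sin`: if `g(x₀) = 0`, `sin x₀ = 0`, `cos x₀ ≠ 0` and `g` is
differentiable at `x₀`, then `g(x)/sin x → g'(x₀)/cos x₀` as `x → x₀`, `x ≠ x₀`. [folklore] -/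
private theorem tendsto_div_sin {g : ℝ → ℝ} {g' x₀ : ℝ} (hg : HasDerivAt g g' x₀) (hg0 : g x₀ = 0)
    (hs0 : Real.sin x₀ = 0) (hc0 : Real.cos x₀ ≠ 0) :
    Tendsto (fun x => g x / Real.sin x) (𝓝[≠] x₀) (𝓝 (g' / Real.cos x₀)) := by
  have h1 := hasDerivAt_iff_tendsto_slope.mp hg
  have h2 := hasDerivAt_iff_tendsto_slope.mp (Real.hasDerivAt_sin x₀)
  refine (h1.div h2 hc0).congr' ?_
  filter_upwards [self_mem_nhdsWithin] with x hx
  have hx' : x - x₀ ≠ 0 := sub_ne_zero.mpr hx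
  rw [Pi.div_apply, slope_def_field, slope_def_field, hg0, hs0, sub_zero, sub_zero,
    div_div_div_cancel_right₀ hx']

/-- A continuous function on `[0, π]` vanishing on `(0, π)` vanishes on `[0, π]`. [folklore] -/
private theorem eq_zero_Icc_of_Ioo {g : ℝ → ℝ} (hg : Continuous g)
    (h : ∀ x ∈ Ioo 0 Real.pi, g x = 0) : ∀ x ∈ Icc 0 Real.pi, g x = 0 := by
  have hsub := closure_minimal h (isClosed_eq hg continuous_const : IsClosed {x : ℝ | g x = 0})
  rw [closure_Ioo Real.pi_pos.ne] at hsub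
  exact fun x hx => hsub hx

/-- **Shvydkoy 2018, Prop. 3.2 (case `α < 1`) for axisymmetric flows, zonal ODE form.** Let
`0 < α < 1` and let `a, b, f` be the `e_φ`-, `e_θ`- and normal components, as functions of the
polar angle `φ`, of a `C²` axisymmetric homogeneous stationary Euler triple on `S²` with vanishing
spherical Bernoulli function `H = a² + b² + f² + 2p ≡ 0`. Then the reduced system (Shvydkoy (6),
axisymmetric form (5.1)–(5.4) with `2p = -(a² + b² + f²)`), written here multiplied by `sin φ`,

  `sin φ·a' = -(2-α) sin φ·f - cos φ·a`, `a f' = (1-α)(a² + b²)`,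
  `sin φ·(b b' + f f') = (1-α) sin φ·f a - cos φ·b²`, `sin φ·a b' = -(1-α) sin φ·f b - cos φ·a b`

on `(0, π)`, together with the pole conditions `b(0) = b(π) = 0`, `f'(0) = f'(π) = 0`, forces
`a = b = f = 0` on `[0, π]`. Printed proof (p. 8), specialised: with the spherical vorticity
`ω = b' + b cot φ` one has `a ω = -(1-α) f b` and the divergence identity
`(sin φ · f ω² a)' = sin φ · ω² (α f² + 3(1-α)(a² + b²)) ≥ 0` (the case `n = 2` of
`div(f ωⁿ v) = (n+α-2) f² ωⁿ + (1-α)(n+1)|v|² ωⁿ`); as `sin φ · f ω² a → 0` at both poles it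
vanishes identically, so pointwise `ω = 0` or `v = f = 0`, whence `f u = 0`: on `{f ≠ 0}`, `b = 0`
and `f' = (1-α) a`, and `(6)₁` becomes the zonal Legendre equation
`f'' + cot φ f' = -(2-α)(1-α) f`, which extends to all of `(0,π)` by continuity/closure; the
zonal spectral gap (`zonal_eigenfunction_eq_zero`, `0 < (2-α)(1-α) < 2`) gives `f ≡ 0`, and then
`(sin φ · a)' = 0`, `(sin² φ · b²)' = 0` give `a = b = 0`. [cite: Shvydkoy2018, Prop. 3.2] -/
theorem zonal_rigidity_of_bernoulli_zero {α : ℝ} (hα0 : 0 < α) (hα1 : α < 1)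
    {a a' b b' b'' f f' f'' : ℝ → ℝ}
    (ha : ∀ x, HasDerivAt a (a' x) x) (hb : ∀ x, HasDerivAt b (b' x) x)
    (hb' : ∀ x, HasDerivAt b' (b'' x) x)
    (hf : ∀ x, HasDerivAt f (f' x) x) (hf' : ∀ x, HasDerivAt f' (f'' x) x)
    (hf''c : Continuous f'')
    (h1 : ∀ φ ∈ Ioo 0 Real.pi,
      Real.sin φ * a' φ = -(2 - α) * Real.sin φ * f φ - Real.cos φ * a φ)
    (h2 : ∀ φ ∈ Ioo 0 Real.pi, a φ * f' φ = (1 - α) * (a φ ^ 2 + b φ ^ 2))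
    (h3 : ∀ φ ∈ Ioo 0 Real.pi, Real.sin φ * (b φ * b' φ + f φ * f' φ) =
      (1 - α) * Real.sin φ * f φ * a φ - Real.cos φ * b φ ^ 2)
    (h4 : ∀ φ ∈ Ioo 0 Real.pi, Real.sin φ * a φ * b' φ =
      -(1 - α) * Real.sin φ * f φ * b φ - Real.cos φ * a φ * b φ)
    (hb0 : b 0 = 0) (hbπ : b Real.pi = 0) (hf'0 : f' 0 = 0) (hf'π : f' Real.pi = 0) :
    ∀ φ ∈ Icc 0 Real.pi, a φ = 0 ∧ b φ = 0 ∧ f φ = 0 := by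
  have hsin : ∀ φ ∈ Ioo 0 Real.pi, 0 < Real.sin φ := fun φ hφ =>
    Real.sin_pos_of_pos_of_lt_pi hφ.1 hφ.2
  have hac : Continuous a := continuous_iff_continuousAt.mpr fun x => (ha x).continuousAt
  have hbc : Continuous b := continuous_iff_continuousAt.mpr fun x => (hb x).continuousAt
  have hb'c : Continuous b' := continuous_iff_continuousAt.mpr fun x => (hb' x).continuousAt
  have hfc : Continuous f := continuous_iff_continuousAt.mpr fun x => (hf x).continuousAt
  have hf'c : Continuous f' := continuous_iff_continuousAt.mpr fun x => (hf' x).continuousAt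
  -- the spherical vorticity `ω = b' + b cot φ`
  set ω : ℝ → ℝ := fun φ => b' φ + Real.cos φ * b φ / Real.sin φ with hω
  have hωs : ∀ φ ∈ Ioo 0 Real.pi, Real.sin φ * ω φ = Real.sin φ * b' φ + Real.cos φ * b φ := by
    intro φ hφ
    have hs := (hsin φ hφ).ne'
    simp only [hω]
    field_simp
  -- (R4) `a ω = -(1-α) f b` and (R3) `f f' = (1-α) f a - ω b`
  have R4 : ∀ φ ∈ Ioo 0 Real.pi, a φ * ω φ = -(1 - α) * f φ * b φ := by
    intro φ hφ
    have hs := hsin φ hφ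
    have key : Real.sin φ * (a φ * ω φ) = Real.sin φ * (-(1 - α) * f φ * b φ) := by
      have := h4 φ hφ
      have hω' := hωs φ hφ
      linear_combination a φ * hω' + this
    exact mul_left_cancel₀ hs.ne' key
  have R3 : ∀ φ ∈ Ioo 0 Real.pi, f φ * f' φ = (1 - α) * f φ * a φ - ω φ * b φ := by
    intro φ hφ
    have hs := hsin φ hφ
    have key : Real.sin φ * (f φ * f' φ) = Real.sin φ * ((1 - α) * f φ * a φ - ω φ * b φ) := by
      have := h3 φ hφ
      have hω' := hωs φ hφ
      linear_combination this + b φ * hω'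
    exact mul_left_cancel₀ hs.ne' key
  -- `ω` is differentiable on `(0, π)`; (R4') the derivative of (R4)
  have hωd : ∀ φ ∈ Ioo 0 Real.pi, HasDerivAt ω (deriv ω φ) φ := by
    intro φ hφ
    have hs := (hsin φ hφ).ne'
    have hd : DifferentiableAt ℝ ω φ := by
      simp only [hω]
      exact (hb' φ).differentiableAt.add
        (((Real.differentiableAt_cos).mul (hb φ).differentiableAt).div
          Real.differentiableAt_sin hs)
    exact hd.hasDerivAt
  have R4' : ∀ φ ∈ Ioo 0 Real.pi,
      a' φ * ω φ + a φ * deriv ω φ = -(1 - α) * (f' φ * b φ + f φ * b' φ) := by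
    intro φ hφ
    have hL : HasDerivAt (fun y => a y * ω y) (a' φ * ω φ + a φ * deriv ω φ) φ :=
      (ha φ).mul (hωd φ hφ)
    have hR : HasDerivAt (fun y => -(1 - α) * (f y * b y))
        (-(1 - α) * (f' φ * b φ + f φ * b' φ)) φ := ((hf φ).mul (hb φ)).const_mul _
    have hev : (fun y => a y * ω y) =ᶠ[𝓝 φ] fun y => -(1 - α) * (f y * b y) := by
      filter_upwards [isOpen_Ioo.mem_nhds hφ] with y hy
      rw [R4 y hy]; ring
    exact hL.unique (hR.congr_of_eventuallyEq hev)
  -- the monotone quantity `Φ = sin φ · f a ω²` and its derivative `Ψ ≥ 0`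
  set Φ : ℝ → ℝ := fun φ => Real.sin φ * f φ * a φ * ω φ ^ 2 with hΦ
  set Ψ : ℝ → ℝ := fun φ =>
    Real.sin φ * ω φ ^ 2 * (α * f φ ^ 2 + 3 * (1 - α) * (a φ ^ 2 + b φ ^ 2)) with hΨ
  have hΦd : ∀ φ ∈ Ioo 0 Real.pi, HasDerivAt Φ (Ψ φ) φ := by
    intro φ hφ
    have e := (((Real.hasDerivAt_sin φ).mul (hf φ)).mul (ha φ)).mul ((hωd φ hφ).pow 2)
    have hfun : Φ = (Real.sin * f * a * ω ^ 2) := by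
      funext x; simp only [hΦ, Pi.mul_apply, Pi.pow_apply]
    rw [hfun]
    refine e.congr_deriv ?_
    simp only [hΨ, Pi.mul_apply, Pi.pow_apply]
    norm_num
    have X1 := h1 φ hφ
    have X2 := h2 φ hφ
    have X4 := R4 φ hφ
    have X4' := R4' φ hφ
    have X5 : Real.sin φ * b' φ = Real.sin φ * ω φ - Real.cos φ * b φ := by
      linarith [hωs φ hφ]
    linear_combination (-(f φ * ω φ ^ 2)) * X1 + (3 * Real.sin φ * ω φ ^ 2) * X2 +
      (-2 * Real.sin φ * f' φ * ω φ + 2 * Real.cos φ * f φ * ω φ) * X4 +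
      (2 * Real.sin φ * f φ * ω φ) * X4' + (-2 * (1 - α) * f φ ^ 2 * ω φ) * X5
  have hΨnn : ∀ φ ∈ Ioo 0 Real.pi, 0 ≤ Ψ φ := by
    intro φ hφ
    simp only [hΨ]
    have hs := (hsin φ hφ).le
    have h1α : 0 ≤ 1 - α := by linarith
    positivity
  -- limits of `ω` at the poles: `b/sin φ → b'(0)` resp. `-b'(π)`
  have hlim : ∀ x₀ : ℝ, (x₀ = 0 ∨ x₀ = Real.pi) → Tendsto Φ (𝓝[≠] x₀) (𝓝 (Φ x₀)) := by
    intro x₀ hx₀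
    have hsx : Real.sin x₀ = 0 := by
      rcases hx₀ with rfl | rfl
      · exact Real.sin_zero
      · exact Real.sin_pi
    have hcx : Real.cos x₀ ≠ 0 := by
      rcases hx₀ with rfl | rfl
      · rw [Real.cos_zero]; exact one_ne_zero
      · rw [Real.cos_pi]; norm_num
    have hbx : b x₀ = 0 := by
      rcases hx₀ with rfl | rfl
      · exact hb0
      · exact hbπ
    have hq : Tendsto (fun x => b x / Real.sin x) (𝓝[≠] x₀) (𝓝 (b' x₀ / Real.cos x₀)) :=
      tendsto_div_sin (hb x₀) hbx hsx hcx
    have hωlim : Tendsto ω (𝓝[≠] x₀) (𝓝 (b' x₀ + Real.cos x₀ * (b' x₀ / Real.cos x₀))) := by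
      have hb't : Tendsto b' (𝓝[≠] x₀) (𝓝 (b' x₀)) :=
        (hb'c.tendsto x₀).mono_left nhdsWithin_le_nhds
      have hcost : Tendsto Real.cos (𝓝[≠] x₀) (𝓝 (Real.cos x₀)) :=
        (Real.continuous_cos.tendsto x₀).mono_left nhdsWithin_le_nhds
      have := hb't.add (hcost.mul hq)
      refine this.congr' (Eventually.of_forall fun x => ?_)
      simp only [hω]
      ring
    have hpre : Tendsto (fun x => Real.sin x * f x * a x) (𝓝[≠] x₀) (𝓝 0) := by
      have hcont : Continuous fun x => Real.sin x * f x * a x :=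
        (Real.continuous_sin.mul hfc).mul hac
      have h0 : Tendsto (fun x => Real.sin x * f x * a x) (𝓝[≠] x₀)
          (𝓝 (Real.sin x₀ * f x₀ * a x₀)) := (hcont.tendsto x₀).mono_left nhdsWithin_le_nhds
      simpa [hsx] using h0
    have hΦ0 : Φ x₀ = 0 := by simp [hΦ, hsx]
    rw [hΦ0]
    have := hpre.mul (hωlim.pow 2)
    simpa [hΦ] using this
  have hΦc : ContinuousOn Φ (Icc 0 Real.pi) := by
    intro x hx
    rcases eq_or_ne x 0 with rfl | hx0
    · exact (continuousWithinAt_compl_self.mp (hlim 0 (Or.inl rfl))).continuousWithinAt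
    rcases eq_or_ne x Real.pi with rfl | hxπ
    · exact (continuousWithinAt_compl_self.mp (hlim _ (Or.inr rfl))).continuousWithinAt
    have hx' : x ∈ Ioo 0 Real.pi := ⟨lt_of_le_of_ne hx.1 (Ne.symm hx0), lt_of_le_of_ne hx.2 hxπ⟩
    exact (hΦd x hx').continuousAt.continuousWithinAt
  -- `Φ` is monotone on `[0, π]` with `Φ(0) = Φ(π) = 0`, hence `Φ ≡ 0` and `Ψ ≡ 0` on `(0, π)`
  have hΦ0 : Φ 0 = 0 := by simp [hΦ]
  have hΦπ : Φ Real.pi = 0 := by simp [hΦ]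
  have hmono : MonotoneOn Φ (Icc 0 Real.pi) := by
    refine monotoneOn_of_deriv_nonneg (convex_Icc 0 Real.pi) hΦc ?_ ?_
    · rw [interior_Icc]; exact fun x hx => (hΦd x hx).differentiableAt.differentiableWithinAt
    · rw [interior_Icc]; intro x hx; rw [(hΦd x hx).deriv]; exact hΨnn x hx
  have hΦzero : ∀ x ∈ Icc 0 Real.pi, Φ x = 0 := by
    intro x hx
    have h0m : (0 : ℝ) ∈ Icc 0 Real.pi := left_mem_Icc.mpr Real.pi_pos.le
    have hπm : Real.pi ∈ Icc 0 Real.pi := right_mem_Icc.mpr Real.pi_pos.le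
    have e1 : Φ 0 ≤ Φ x := hmono h0m hx hx.1
    have e2 : Φ x ≤ Φ Real.pi := hmono hx hπm hx.2
    linarith
  have hΨzero : ∀ φ ∈ Ioo 0 Real.pi, Ψ φ = 0 := by
    intro φ hφ
    have hev : Φ =ᶠ[𝓝 φ] fun _ => (0 : ℝ) := by
      filter_upwards [isOpen_Ioo.mem_nhds hφ] with y hy
      exact hΦzero y (Ioo_subset_Icc_self hy)
    exact (hΦd φ hφ).unique ((hasDerivAt_const φ (0 : ℝ)).congr_of_eventuallyEq hev)
  -- pointwise: `ω = 0` or `a = b = f = 0`; hence `f ((1-α) a - f') = 0` (`f u = 0`)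
  have hdich : ∀ φ ∈ Ioo 0 Real.pi, ω φ = 0 ∨ (f φ = 0 ∧ a φ = 0 ∧ b φ = 0) := by
    intro φ hφ
    have hΨ0 := hΨzero φ hφ
    simp only [hΨ] at hΨ0
    have hs := hsin φ hφ
    rcases mul_eq_zero.mp hΨ0 with h12 | h3'
    · rcases mul_eq_zero.mp h12 with hs0 | hω0
      · exact absurd hs0 hs.ne'
      · exact Or.inl (pow_eq_zero_iff two_ne_zero |>.mp hω0)
    · right
      have h1α : 0 < 1 - α := by linarith
      have hf2 : f φ ^ 2 = 0 := by nlinarith [sq_nonneg (f φ), sq_nonneg (a φ), sq_nonneg (b φ)]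
      have ha2 : a φ ^ 2 = 0 := by nlinarith [sq_nonneg (f φ), sq_nonneg (a φ), sq_nonneg (b φ)]
      have hb2 : b φ ^ 2 = 0 := by nlinarith [sq_nonneg (f φ), sq_nonneg (a φ), sq_nonneg (b φ)]
      exact ⟨pow_eq_zero_iff two_ne_zero |>.mp hf2, pow_eq_zero_iff two_ne_zero |>.mp ha2,
        pow_eq_zero_iff two_ne_zero |>.mp hb2⟩
  have hfu : ∀ φ ∈ Ioo 0 Real.pi, f φ * ((1 - α) * a φ - f' φ) = 0 := by
    intro φ hφ
    rcases hdich φ hφ with hω0 | ⟨hf0, -, -⟩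
    · have := R3 φ hφ
      rw [hω0, zero_mul, sub_zero] at this
      linear_combination -this
    · rw [hf0, zero_mul]
  -- the zonal Legendre equation holds on all of `(0, π)`
  set lam : ℝ := (1 - α) * (2 - α) with hlam
  set U : Set ℝ := {y | y ∈ Ioo 0 Real.pi ∧ f y ≠ 0} with hU
  have hUo : IsOpen U := isOpen_Ioo.inter (isOpen_ne_fun hfc continuous_const)
  have hleg_U : ∀ y ∈ U, Real.sin y * f'' y + Real.cos y * f' y + lam * Real.sin y * f y = 0 := by
    intro y hy
    have hev : f' =ᶠ[𝓝 y] fun z => (1 - α) * a z := by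
      filter_upwards [hUo.mem_nhds hy] with z hz
      have := hfu z hz.1
      have hfz : f z ≠ 0 := hz.2
      have : (1 - α) * a z - f' z = 0 := (mul_eq_zero.mp this).resolve_left hfz
      linarith
    have hD : HasDerivAt f' ((1 - α) * a' y) y :=
      ((ha y).const_mul (1 - α)).congr_of_eventuallyEq hev
    have hf''y : f'' y = (1 - α) * a' y := (hf' y).unique hD
    have hf'y : f' y = (1 - α) * a y := hev.eq_of_nhds
    have hs := (hsin y hy.1).ne'
    have X1 := h1 y hy.1
    rw [hf''y, hf'y, hlam]
    linear_combination (1 - α) * X1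
  have hleg : ∀ φ ∈ Ioo 0 Real.pi,
      Real.sin φ * f'' φ + Real.cos φ * f' φ = -lam * Real.sin φ * f φ := by
    intro φ hφ
    by_cases hcl : φ ∈ closure U
    · have hS : IsClosed {y : ℝ | Real.sin y * f'' y + Real.cos y * f' y +
          lam * Real.sin y * f y = 0} :=
        isClosed_eq ((((Real.continuous_sin.mul hf''c).add (Real.continuous_cos.mul hf'c)).add
          ((continuous_const.mul Real.continuous_sin).mul hfc))) continuous_const
      have hsub : closure U ⊆ _ := closure_minimal hleg_U hS
      have hmem : Real.sin φ * f'' φ + Real.cos φ * f' φ + lam * Real.sin φ * f φ = 0 :=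
        hsub hcl
      linarith
    · -- near `φ`, `f ≡ 0`
      have hW : (closure U)ᶜ ∩ Ioo 0 Real.pi ∈ 𝓝 φ :=
        inter_mem (isClosed_closure.isOpen_compl.mem_nhds hcl) (isOpen_Ioo.mem_nhds hφ)
      have hf0 : ∀ z ∈ (closure U)ᶜ ∩ Ioo 0 Real.pi, f z = 0 := by
        intro z hz
        by_contra hne
        exact hz.1 (subset_closure ⟨hz.2, hne⟩)
      have hfev : ∀ z ∈ (closure U)ᶜ ∩ Ioo 0 Real.pi, f =ᶠ[𝓝 z] fun _ => (0 : ℝ) := by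
        intro z hz
        have hWz : (closure U)ᶜ ∩ Ioo 0 Real.pi ∈ 𝓝 z :=
          inter_mem (isClosed_closure.isOpen_compl.mem_nhds hz.1) (isOpen_Ioo.mem_nhds hz.2)
        filter_upwards [hWz] with w hw
        exact hf0 w hw
      have hf'0 : ∀ z ∈ (closure U)ᶜ ∩ Ioo 0 Real.pi, f' z = 0 := fun z hz =>
        (hf z).unique ((hasDerivAt_const z (0 : ℝ)).congr_of_eventuallyEq (hfev z hz))
      have hf'ev : f' =ᶠ[𝓝 φ] fun _ => (0 : ℝ) := by
        filter_upwards [hW] with w hw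
        exact hf'0 w hw
      have hf''φ : f'' φ = 0 :=
        (hf' φ).unique ((hasDerivAt_const φ (0 : ℝ)).congr_of_eventuallyEq hf'ev)
      have hφW : φ ∈ (closure U)ᶜ ∩ Ioo 0 Real.pi := ⟨hcl, hφ⟩
      rw [hf''φ, hf'0 φ hφW, hf0 φ hφW]
      ring
  -- the zonal spectral gap: `f ≡ 0`
  have hlam0 : 0 < lam := by rw [hlam]; nlinarith
  have hlam2 : lam < 2 := by rw [hlam]; nlinarith
  have hfz : ∀ φ ∈ Icc 0 Real.pi, f φ = 0 :=
    zonal_eigenfunction_eq_zero hlam0 hlam2 hf hf' hleg hf'0 hf'π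
  -- `a ≡ 0`: `(sin φ · a)' = 0`
  have haz : ∀ φ ∈ Ioo 0 Real.pi, a φ = 0 := by
    have hg : ∀ x ∈ Icc 0 Real.pi, Real.sin x * a x = Real.sin 0 * a 0 := by
      refine eq_of_hasDerivAt_zero_Ioo Real.pi_pos.le
        ((Real.continuous_sin.mul hac).continuousOn) fun x hx => ?_
      have e := (Real.hasDerivAt_sin x).mul (ha x)
      refine e.congr_deriv ?_
      have X1 := h1 x hx
      have hf0 := hfz x (Ioo_subset_Icc_self hx)
      rw [hf0] at X1
      linear_combination X1
    intro φ hφ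
    have := hg φ (Ioo_subset_Icc_self hφ)
    rw [Real.sin_zero, zero_mul] at this
    exact (mul_eq_zero.mp this).resolve_left (hsin φ hφ).ne'
  -- `b ≡ 0`: `((sin φ · b)²)' = 0`
  have hbz : ∀ φ ∈ Ioo 0 Real.pi, b φ = 0 := by
    have hg : ∀ x ∈ Icc 0 Real.pi, (Real.sin x * b x) ^ 2 = (Real.sin 0 * b 0) ^ 2 := by
      refine eq_of_hasDerivAt_zero_Ioo Real.pi_pos.le
        (((Real.continuous_sin.mul hbc).pow 2).continuousOn) fun x hx => ?_
      have e := ((Real.hasDerivAt_sin x).mul (hb x)).pow 2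
      refine e.congr_deriv ?_
      simp only [Nat.reduceSub, pow_one, Nat.cast_ofNat, Pi.mul_apply]
      have X3 := h3 x hx
      have hf0 := hfz x (Ioo_subset_Icc_self hx)
      rw [hf0] at X3
      linear_combination 2 * Real.sin x * X3
    intro φ hφ
    have := hg φ (Ioo_subset_Icc_self hφ)
    rw [Real.sin_zero, zero_mul, zero_pow two_ne_zero] at this
    have h' : Real.sin φ * b φ = 0 := pow_eq_zero_iff two_ne_zero |>.mp this
    exact (mul_eq_zero.mp h').resolve_left (hsin φ hφ).ne'
  -- conclusion on `[0, π]`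
  have ha' := eq_zero_Icc_of_Ioo hac haz
  have hb'' := eq_zero_Icc_of_Ioo hbc hbz
  exact fun φ hφ => ⟨ha' φ hφ, hb'' φ hφ, hfz φ hφ⟩

end Shvydkoy2018

end Literature.Analysis.FluidPDE
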